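import Summits.Ventures.PercRepro.ProfilePointedCircuitClassesTwelveSeriesB

/-!
# PercRepro — THE CAPTURE IDENTITY ALONG A SERIES PAIR AND THE CAPTURE REDUCTION OF THE TWELVE-POINT STATEMENT
(p5, gen 45; `proofs/P5-GM1.md` §67)

On `#E = 12`, `ρ(E) = 7`, with a series pair `{a, a'}` of `N` avoiding the point `e`, write `𝒟` for the
bi-independent `5`-sets containing `e` (`in_5(e) = #𝒟`) and `𝒰` for the bi-independent `6`-sets avoiding `e`
(`out_6(e) = #𝒰`), and split both by the membership of `a, a'`.  Two further bijections `W ↦ (E ∖ W) − a'`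
(`card_filter_sdiff_erase_eq_of_not_mem`, `card_filter_sdiff_erase_eq_of_mem`) identify the demands avoiding
`a, a'` with the units `S ∋ a ∌ a'` with `a' ∉ cl(S)`, and the units avoiding `a, a'` with the demands `W ∋ a`
with `a' ∉ cl(W)`.  Hence THE CAPTURE IDENTITY (`outCount_six_add_eq_of_seriesPair`)
  `out_6(e) + d_a + δ = in_5(e) + u_a + (u₂ + y)`,
where `d_a = #{W ∈ 𝒟 : a ∈ W}`, `u_a = #{S ∈ 𝒰 : a ∈ S ∌ a'}`, `δ = #{W ∈ 𝒟 : a ∈ W, a' ∈ cl(W)}`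
(the CAPTURED demands) and `u₂ + y = #{S ∈ 𝒰 : a ∈ S, a' ∈ cl(S)}` (the CAPTURING units — those containing
both `a, a'` and those containing `a` whose closure contains `a'`).  Since `d_a ≤ u_a` is the `n = 10`
theorem `inOutBottomFour_holds` on `N ／ a ∖ a'` (TwelveSeriesB), THE CAPTURE REDUCTION
(`inCount_five_le_outCount_six_of_seriesPair_of_capture`, module TwelveCaptureB) reads: `in_5(e) ≤ out_6(e)` follows from
  (C)  `#{W ∈ 𝒟 : a ∈ W, ρ(W + a') = ρ(W)} ≤ #{S ∈ 𝒰 : a ∈ S, ρ(S + a') = ρ(S)}`,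
the in–out inequality restricted to the sets whose closure contains the cocircuit `{a, a'}`.  (C) is strictly
weaker than the refuted eleven-point inequality `(★)` of §66 (`(★) ⟺ u₂ + y − δ ≥ u_a − d_a`) and is
census-true with room where `(★)` fails (§67).  Nothing here asserts (C).
-/

open scoped Matroid

namespace PercRepro.Cogirth

open Finset ThmH Skew Shadow Profile

variable {α : Type} [DecidableEq α] {N : Matroid α} [N.Finite]

section TwelveCaptureA

/-! ### The complement-minus-a' map -/

/-- `E ∖ ((E ∖ W) − a') = W + a'` for `W ⊆ E` and `a' ∈ E ∖ W`. -/
theorem sdiff_sdiff_erase_eq_insert {W : Finset α} (hWg : W ⊆ gr N) {a' : α} (ha' : a' ∈ gr N)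
    (ha'W : a' ∉ W) : gr N \ (gr N \ W).erase a' = insert a' W := by
  ext y
  constructor
  · intro hy
    rw [mem_sdiff, mem_erase, mem_sdiff] at hy
    obtain ⟨hyg, hy⟩ := hy
    rw [mem_insert]
    by_cases hya : y = a'
    · exact Or.inl hya
    · right
      by_contra hyW
      exact hy ⟨hya, hyg, hyW⟩
  · intro hy
    rw [mem_insert] at hy
    rw [mem_sdiff, mem_erase, mem_sdiff]
    rcases hy with rfl | hyW
    · exact ⟨ha', fun h => h.1 rfl⟩
    · exact ⟨hWg hyW, fun h => h.2.2 hyW⟩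

/-- For a bi-independent `5`-set `W` of a `12`-point matroid and a point `a' ∉ W`, the `6`-set `(E ∖ W) − a'` is
bi-independent iff `ρ(W + a') = 6` (its complement is `W + a'`; it is itself a subset of the basis `E ∖ W`). -/
theorem sdiff_erase_mem_biIndepSets_six_iff (hn : (gr N).card = 12) {W : Finset α}
    (hW : W ∈ biIndepSets N 5) {a' : α} (ha' : a' ∈ gr N) (ha'W : a' ∉ W) :
    (gr N \ W).erase a' ∈ biIndepSets N 6 ↔ rk N (insert a' W) = 6 := by
  obtain ⟨hWg, hWc, hWr, hWcompl⟩ := mem_biIndepSets.1 hW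
  have ha'c : a' ∈ gr N \ W := mem_sdiff.2 ⟨ha', ha'W⟩
  have hccard : (gr N \ W).card = 7 := by rw [card_sdiff_of_subset hWg, hn, hWc]
  have hScard : ((gr N \ W).erase a').card = 6 := by rw [card_erase_of_mem ha'c, hccard]
  have hSsub : (gr N \ W).erase a' ⊆ gr N := (erase_subset _ _).trans sdiff_subset
  have hSrk : rk N ((gr N \ W).erase a') = 6 := by
    rw [← hScard]
    exact rk_eq_card_of_subset_of_rk_eq_card (erase_subset _ _) hWcompl
  have hicard : (insert a' W).card = 6 := by rw [card_insert_of_notMem ha'W, hWc]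
  rw [mem_biIndepSets, sdiff_sdiff_erase_eq_insert hWg ha' ha'W, hScard, hSrk, hicard]
  exact ⟨fun h => h.2.2.2, fun h => ⟨hSsub, rfl, rfl, h⟩⟩

/-- For a bi-independent `6`-set `S` of a `12`-point matroid and a point `a' ∉ S`, the `5`-set `(E ∖ S) − a'` is
bi-independent iff `ρ(S + a') = 7`. -/
theorem sdiff_erase_mem_biIndepSets_five_iff (hn : (gr N).card = 12) {S : Finset α}
    (hS : S ∈ biIndepSets N 6) {a' : α} (ha' : a' ∈ gr N) (ha'S : a' ∉ S) :
    (gr N \ S).erase a' ∈ biIndepSets N 5 ↔ rk N (insert a' S) = 7 := by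
  obtain ⟨hSg, hSc, hSr, hScompl⟩ := mem_biIndepSets.1 hS
  have ha'c : a' ∈ gr N \ S := mem_sdiff.2 ⟨ha', ha'S⟩
  have hccard : (gr N \ S).card = 6 := by rw [card_sdiff_of_subset hSg, hn, hSc]
  have hWcard : ((gr N \ S).erase a').card = 5 := by rw [card_erase_of_mem ha'c, hccard]
  have hWsub : (gr N \ S).erase a' ⊆ gr N := (erase_subset _ _).trans sdiff_subset
  have hWrk : rk N ((gr N \ S).erase a') = 5 := by
    rw [← hWcard]
    exact rk_eq_card_of_subset_of_rk_eq_card (erase_subset _ _) hScompl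
  have hicard : (insert a' S).card = 7 := by rw [card_insert_of_notMem ha'S, hSc]
  rw [mem_biIndepSets, sdiff_sdiff_erase_eq_insert hSg ha' ha'S, hWcard, hWrk, hicard]
  exact ⟨fun h => h.2.2.2, fun h => ⟨hWsub, rfl, rfl, h⟩⟩

/-- The rank of the complement of a bi-independent `5`-set of a `12`-point matroid is `7`. -/
theorem rk_sdiff_eq_seven_of_mem_biIndepSets_five (hn : (gr N).card = 12) {W : Finset α}
    (hW : W ∈ biIndepSets N 5) : rk N (gr N \ W) = 7 := by
  obtain ⟨hWg, hWc, -, hWcompl⟩ := mem_biIndepSets.1 hW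
  rw [card_sdiff_of_subset hWg, hn, hWc] at hWcompl
  omega

/-- The rank of the complement of a bi-independent `6`-set of a `12`-point matroid is `6`. -/
theorem rk_sdiff_eq_six_of_mem_biIndepSets_six (hn : (gr N).card = 12) {S : Finset α}
    (hS : S ∈ biIndepSets N 6) : rk N (gr N \ S) = 6 := by
  obtain ⟨hSg, hSc, -, hScompl⟩ := mem_biIndepSets.1 hS
  rw [card_sdiff_of_subset hSg, hn, hSc] at hScompl
  omega

/-- **THE FIRST BIJECTION** `W ↦ (E ∖ W) − a'`: the bi-independent `5`-sets `W ∋ e` avoiding `a, a'` with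
`ρ(W + a') = 6` correspond to the bi-independent `6`-sets `S ∌ e` containing `a` but not `a'` with `ρ(S + a') = 7`
(inverse `S ↦ (E ∖ S) − a'`). -/
theorem card_filter_sdiff_erase_eq_of_not_mem (hn : (gr N).card = 12) {e a a' : α} (he : e ∈ gr N)
    (ha : a ∈ gr N) (ha' : a' ∈ gr N) (hea' : e ≠ a') (haa' : a ≠ a') :
    ((biIndepSets N 5).filter (fun W => ((e ∈ W ∧ a ∉ W) ∧ a' ∉ W) ∧ rk N (insert a' W) = 6)).card =
      ((biIndepSets N 6).filter (fun S => ((e ∉ S ∧ a ∈ S) ∧ a' ∉ S) ∧ rk N (insert a' S) = 7)).card := by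
  apply card_bij (fun W _ => (gr N \ W).erase a')
  · intro W hW
    rw [mem_filter] at hW ⊢
    obtain ⟨hWb, ⟨⟨heW, haW⟩, ha'W⟩, hrk⟩ := hW
    refine ⟨(sdiff_erase_mem_biIndepSets_six_iff hn hWb ha' ha'W).2 hrk, ⟨⟨?_, ?_⟩, ?_⟩, ?_⟩
    · exact fun h' => (mem_sdiff.1 (mem_of_mem_erase h')).2 heW
    · exact mem_erase.2 ⟨haa', mem_sdiff.2 ⟨ha, haW⟩⟩
    · exact fun h' => (mem_erase.1 h').1 rfl
    · rw [insert_erase (mem_sdiff.2 ⟨ha', ha'W⟩)]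
      exact rk_sdiff_eq_seven_of_mem_biIndepSets_five hn hWb
  · intro W₁ hW₁ W₂ hW₂ heq
    rw [mem_filter] at hW₁ hW₂
    have h₁ : W₁ ⊆ gr N := (mem_biIndepSets.1 hW₁.1).1
    have h₂ : W₂ ⊆ gr N := (mem_biIndepSets.1 hW₂.1).1
    have ha'₁ : a' ∈ gr N \ W₁ := mem_sdiff.2 ⟨ha', hW₁.2.1.2⟩
    have ha'₂ : a' ∈ gr N \ W₂ := mem_sdiff.2 ⟨ha', hW₂.2.1.2⟩
    have heq' : (gr N \ W₁).erase a' = (gr N \ W₂).erase a' := heq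
    have h3 : gr N \ W₁ = gr N \ W₂ := by
      rw [← insert_erase ha'₁, ← insert_erase ha'₂, heq']
    rw [← Finset.sdiff_sdiff_eq_self h₁, ← Finset.sdiff_sdiff_eq_self h₂, h3]
  · intro S hS
    rw [mem_filter] at hS
    obtain ⟨hSb, ⟨⟨heS, haS⟩, ha'S⟩, hrk⟩ := hS
    have hSg : S ⊆ gr N := (mem_biIndepSets.1 hSb).1
    refine ⟨(gr N \ S).erase a', ?_, ?_⟩
    · rw [mem_filter]
      refine ⟨(sdiff_erase_mem_biIndepSets_five_iff hn hSb ha' ha'S).2 hrk, ⟨⟨?_, ?_⟩, ?_⟩, ?_⟩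
      · exact mem_erase.2 ⟨hea', mem_sdiff.2 ⟨he, heS⟩⟩
      · exact fun h' => (mem_sdiff.1 (mem_of_mem_erase h')).2 haS
      · exact fun h' => (mem_erase.1 h').1 rfl
      · rw [insert_erase (mem_sdiff.2 ⟨ha', ha'S⟩)]
        exact rk_sdiff_eq_six_of_mem_biIndepSets_six hn hSb
    · show (gr N \ (gr N \ S).erase a').erase a' = S
      rw [sdiff_sdiff_erase_eq_insert hSg ha' ha'S, erase_insert ha'S]

/-- **THE SECOND BIJECTION** `W ↦ (E ∖ W) − a'`: the bi-independent `5`-sets `W ∋ e, a` with `a' ∉ W` and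
`ρ(W + a') = 6` correspond to the bi-independent `6`-sets `S` avoiding `e, a, a'` with `ρ(S + a') = 7`. -/
theorem card_filter_sdiff_erase_eq_of_mem (hn : (gr N).card = 12) {e a a' : α} (he : e ∈ gr N)
    (ha : a ∈ gr N) (ha' : a' ∈ gr N) (hea' : e ≠ a') (haa' : a ≠ a') :
    ((biIndepSets N 5).filter (fun W => ((e ∈ W ∧ a ∈ W) ∧ a' ∉ W) ∧ rk N (insert a' W) = 6)).card =
      ((biIndepSets N 6).filter (fun S => ((e ∉ S ∧ a ∉ S) ∧ a' ∉ S) ∧ rk N (insert a' S) = 7)).card := by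
  apply card_bij (fun W _ => (gr N \ W).erase a')
  · intro W hW
    rw [mem_filter] at hW ⊢
    obtain ⟨hWb, ⟨⟨heW, haW⟩, ha'W⟩, hrk⟩ := hW
    refine ⟨(sdiff_erase_mem_biIndepSets_six_iff hn hWb ha' ha'W).2 hrk, ⟨⟨?_, ?_⟩, ?_⟩, ?_⟩
    · exact fun h' => (mem_sdiff.1 (mem_of_mem_erase h')).2 heW
    · exact fun h' => (mem_sdiff.1 (mem_of_mem_erase h')).2 haW
    · exact fun h' => (mem_erase.1 h').1 rfl
    · rw [insert_erase (mem_sdiff.2 ⟨ha', ha'W⟩)]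
      exact rk_sdiff_eq_seven_of_mem_biIndepSets_five hn hWb
  · intro W₁ hW₁ W₂ hW₂ heq
    rw [mem_filter] at hW₁ hW₂
    have h₁ : W₁ ⊆ gr N := (mem_biIndepSets.1 hW₁.1).1
    have h₂ : W₂ ⊆ gr N := (mem_biIndepSets.1 hW₂.1).1
    have ha'₁ : a' ∈ gr N \ W₁ := mem_sdiff.2 ⟨ha', hW₁.2.1.2⟩
    have ha'₂ : a' ∈ gr N \ W₂ := mem_sdiff.2 ⟨ha', hW₂.2.1.2⟩
    have heq' : (gr N \ W₁).erase a' = (gr N \ W₂).erase a' := heq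
    have h3 : gr N \ W₁ = gr N \ W₂ := by
      rw [← insert_erase ha'₁, ← insert_erase ha'₂, heq']
    rw [← Finset.sdiff_sdiff_eq_self h₁, ← Finset.sdiff_sdiff_eq_self h₂, h3]
  · intro S hS
    rw [mem_filter] at hS
    obtain ⟨hSb, ⟨⟨heS, haS⟩, ha'S⟩, hrk⟩ := hS
    have hSg : S ⊆ gr N := (mem_biIndepSets.1 hSb).1
    refine ⟨(gr N \ S).erase a', ?_, ?_⟩
    · rw [mem_filter]
      refine ⟨(sdiff_erase_mem_biIndepSets_five_iff hn hSb ha' ha'S).2 hrk, ⟨⟨?_, ?_⟩, ?_⟩, ?_⟩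
      · exact mem_erase.2 ⟨hea', mem_sdiff.2 ⟨he, heS⟩⟩
      · exact mem_erase.2 ⟨haa', mem_sdiff.2 ⟨ha, haS⟩⟩
      · exact fun h' => (mem_erase.1 h').1 rfl
      · rw [insert_erase (mem_sdiff.2 ⟨ha', ha'S⟩)]
        exact rk_sdiff_eq_six_of_mem_biIndepSets_six hn hSb
    · show (gr N \ (gr N \ S).erase a').erase a' = S
      rw [sdiff_sdiff_erase_eq_insert hSg ha' ha'S, erase_insert ha'S]

/-! ### The capture identity -/

/-- **THE CAPTURE IDENTITY ALONG A SERIES PAIR**: on `#E = 12`, `ρ(E) = 7`, with a series pair `{a, a'}`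
avoiding `e`,
  `out_6(e) + d_a + δ = in_5(e) + u_a + (u₂ + y)`,
where `d_a = #{W ∈ BI_5 : e ∈ W, a ∈ W, a' ∉ W}`, `δ = #{W ∈ BI_5 : e ∈ W, a ∈ W, ρ(W + a') = 5}` (the demands
whose closure contains `a'`), `u_a = #{S ∈ BI_6 : e ∉ S, a ∈ S, a' ∉ S}` and
`u₂ + y = #{S ∈ BI_6 : e ∉ S, a ∈ S, ρ(S + a') = 6}` (the units whose closure contains `a'`, including those
containing `a'`).  Proof: the four-cell splits of `in_5(e)` and `out_6(e)` by the membership of `a, a'`, the swap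
`W ↦ W − a + a'` (no bi-independent `5`-set contains both), and the two bijections `W ↦ (E ∖ W) − a'`:
`#{W ∈ 𝒟 : a, a' ∉ W} = #{S ∈ 𝒰 : a ∈ S ∌ a', ρ(S + a') = 7}` and
`#{S ∈ 𝒰 : a, a' ∉ S} = #{W ∈ 𝒟 : a ∈ W ∌ a', ρ(W + a') = 6}`. -/
theorem outCount_six_add_eq_of_seriesPair {a a' e : α} (hn : (gr N).card = 12) (hR : rk N (gr N) = 7)
    (h : SeriesPair N a a') (he : e ∈ gr N) (hea : e ≠ a) (hea' : e ≠ a') :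
    outCount N 6 e + (((biIndepSets N 5).filter (fun W => (e ∈ W ∧ a ∈ W) ∧ a' ∉ W)).card +
        ((biIndepSets N 5).filter (fun W => (e ∈ W ∧ a ∈ W) ∧ rk N (insert a' W) = 5)).card) =
      inCount N 5 e + (((biIndepSets N 6).filter (fun S => (e ∉ S ∧ a ∈ S) ∧ a' ∉ S)).card +
        ((biIndepSets N 6).filter (fun S => (e ∉ S ∧ a ∈ S) ∧ rk N (insert a' S) = 6)).card) := by
  have ha : a ∈ gr N := h.1
  have ha' : a' ∈ gr N := h.2.1
  have hne : a ≠ a' := h.2.2.1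
  have hn5 : (gr N).card = rk N (gr N) + 5 := by omega
  -- the membership predicates, swap-invariant
  have hPe : ∀ W : Finset α, e ∈ insert a' (W.erase a) ↔ e ∈ W := by
    intro W
    rw [mem_insert, mem_erase]
    constructor
    · rintro (h' | ⟨_, h'⟩)
      · exact absurd h' hea'
      · exact h'
    · intro h'
      exact Or.inr ⟨hea, h'⟩
  have hPe' : ∀ W : Finset α, e ∈ insert a (W.erase a') ↔ e ∈ W := by
    intro W
    rw [mem_insert, mem_erase]
    constructor
    · rintro (h' | ⟨_, h'⟩)
      · exact absurd h' hea
      · exact h'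
    · intro h'
      exact Or.inr ⟨hea', h'⟩
  have hQe : ∀ W : Finset α, e ∉ insert a' (W.erase a) ↔ e ∉ W := fun W => not_congr (hPe W)
  have hQe' : ∀ W : Finset α, e ∉ insert a (W.erase a') ↔ e ∉ W := fun W => not_congr (hPe' W)
  -- the four-cell splits and the swaps
  have hD := card_filter_eq_sum_four (biIndepSets N 5) (fun W => e ∈ W) a a'
  have hU := card_filter_eq_sum_four (biIndepSets N 6) (fun W => e ∉ W) a a'
  have hboth : ((biIndepSets N 5).filter (fun W => (e ∈ W ∧ a ∈ W) ∧ a' ∈ W)).card = 0 := by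
    rw [card_eq_zero, filter_eq_empty_iff]
    rintro W hW ⟨⟨_, haW⟩, ha'W⟩
    exact not_mem_of_mem_biIndepSets_of_seriesPair h hn5 hW haW ha'W
  have hD1 := card_filter_swap_of_seriesPair h 5 (fun W => e ∈ W) hPe hPe'
  have hU1 := card_filter_swap_of_seriesPair h 6 (fun W => e ∉ W) hQe hQe'
  -- the splits of `d_a` and `u_a` by the rank of `W + a'`, `S + a'`
  have hDa := card_filter_add_card_filter_not
    (s := (biIndepSets N 5).filter (fun W => (e ∈ W ∧ a ∈ W) ∧ a' ∉ W)) (fun W => rk N (insert a' W) = 6)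
  simp only [filter_filter] at hDa
  have hUa := card_filter_add_card_filter_not
    (s := (biIndepSets N 6).filter (fun S => (e ∉ S ∧ a ∈ S) ∧ a' ∉ S)) (fun S => rk N (insert a' S) = 7)
  simp only [filter_filter] at hUa
  -- the captured demands: `ρ(W + a') ≠ 6` is `ρ(W + a') = 5`, and `a' ∉ W` is automatic
  have hDc : ((biIndepSets N 5).filter
      (fun W => ((e ∈ W ∧ a ∈ W) ∧ a' ∉ W) ∧ ¬ rk N (insert a' W) = 6)).card =
      ((biIndepSets N 5).filter (fun W => (e ∈ W ∧ a ∈ W) ∧ rk N (insert a' W) = 5)).card := by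
    apply congrArg Finset.card
    apply filter_congr
    intro W hW
    have hWg : W ⊆ gr N := (mem_biIndepSets.1 hW).1
    have h3 : rk N W = 5 := by rw [(mem_biIndepSets.1 hW).2.2.1, (mem_biIndepSets.1 hW).2.1]
    have h1 : rk N (insert a' W) ≤ rk N W + 1 := rk_insert_le_add_one ha' hWg
    have h2 : rk N W ≤ rk N (insert a' W) := rk_mono' (subset_insert _ _)
    constructor
    · rintro ⟨⟨⟨heW, haW⟩, _⟩, hrk⟩
      exact ⟨⟨heW, haW⟩, by omega⟩
    · rintro ⟨⟨heW, haW⟩, hrk⟩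
      exact ⟨⟨⟨heW, haW⟩, not_mem_of_mem_biIndepSets_of_seriesPair h hn5 hW haW⟩, by omega⟩
  -- the capturing units: those containing `a'` and those with `ρ(S + a') ≠ 7`, i.e. `= 6`
  have hUc : ((biIndepSets N 6).filter
      (fun S => ((e ∉ S ∧ a ∈ S) ∧ a' ∉ S) ∧ ¬ rk N (insert a' S) = 7)).card +
      ((biIndepSets N 6).filter (fun S => (e ∉ S ∧ a ∈ S) ∧ a' ∈ S)).card =
      ((biIndepSets N 6).filter (fun S => (e ∉ S ∧ a ∈ S) ∧ rk N (insert a' S) = 6)).card := by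
    have hsplit := card_filter_add_card_filter_not
      (s := (biIndepSets N 6).filter (fun S => (e ∉ S ∧ a ∈ S) ∧ rk N (insert a' S) = 6)) (fun S => a' ∈ S)
    simp only [filter_filter] at hsplit
    have e1 : ((biIndepSets N 6).filter
        (fun S => ((e ∉ S ∧ a ∈ S) ∧ rk N (insert a' S) = 6) ∧ a' ∈ S)).card =
        ((biIndepSets N 6).filter (fun S => (e ∉ S ∧ a ∈ S) ∧ a' ∈ S)).card := by
      apply congrArg Finset.card
      apply filter_congr
      intro S hS
      constructor
      · rintro ⟨⟨hp, _⟩, ha'S⟩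
        exact ⟨hp, ha'S⟩
      · rintro ⟨hp, ha'S⟩
        refine ⟨⟨hp, ?_⟩, ha'S⟩
        rw [insert_eq_of_mem ha'S, (mem_biIndepSets.1 hS).2.2.1, (mem_biIndepSets.1 hS).2.1]
    have e2 : ((biIndepSets N 6).filter
        (fun S => ((e ∉ S ∧ a ∈ S) ∧ rk N (insert a' S) = 6) ∧ ¬ a' ∈ S)).card =
        ((biIndepSets N 6).filter
          (fun S => ((e ∉ S ∧ a ∈ S) ∧ a' ∉ S) ∧ ¬ rk N (insert a' S) = 7)).card := by
      apply congrArg Finset.card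
      apply filter_congr
      intro S hS
      have hSg : S ⊆ gr N := (mem_biIndepSets.1 hS).1
      have h3 : rk N S = 6 := by rw [(mem_biIndepSets.1 hS).2.2.1, (mem_biIndepSets.1 hS).2.1]
      have h1 : rk N (insert a' S) ≤ rk N S + 1 := rk_insert_le_add_one ha' hSg
      have h2 : rk N S ≤ rk N (insert a' S) := rk_mono' (subset_insert _ _)
      constructor
      · rintro ⟨⟨hp, hrk⟩, ha'S⟩
        exact ⟨⟨hp, ha'S⟩, by omega⟩
      · rintro ⟨⟨hp, ha'S⟩, hrk⟩
        exact ⟨⟨hp, by omega⟩, ha'S⟩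
    omega
  -- the two bijections, with the automatic rank conditions removed
  have hB1 := card_filter_sdiff_erase_eq_of_not_mem hn he ha ha' hea' hne
  have hB2 := card_filter_sdiff_erase_eq_of_mem hn he ha ha' hea' hne
  have hD0 : ((biIndepSets N 5).filter
      (fun W => ((e ∈ W ∧ a ∉ W) ∧ a' ∉ W) ∧ rk N (insert a' W) = 6)).card =
      ((biIndepSets N 5).filter (fun W => (e ∈ W ∧ a ∉ W) ∧ a' ∉ W)).card := by
    apply congrArg Finset.card
    apply filter_congr
    intro W hW
    constructor
    · rintro ⟨hp, _⟩
      exact hp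
    · rintro ⟨⟨heW, haW⟩, ha'W⟩
      refine ⟨⟨⟨heW, haW⟩, ha'W⟩, ?_⟩
      have hWsub : W ⊆ ((gr N).erase a).erase a' := by
        intro y hy
        exact mem_erase.2 ⟨fun h' => ha'W (h' ▸ hy),
          mem_erase.2 ⟨fun h' => haW (h' ▸ hy), (mem_biIndepSets.1 hW).1 hy⟩⟩
      rw [rk_insert_right_eq_add_one_of_seriesPair h hWsub, (mem_biIndepSets.1 hW).2.2.1,
        (mem_biIndepSets.1 hW).2.1]
  have hU0 : ((biIndepSets N 6).filter
      (fun S => ((e ∉ S ∧ a ∉ S) ∧ a' ∉ S) ∧ rk N (insert a' S) = 7)).card =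
      ((biIndepSets N 6).filter (fun S => (e ∉ S ∧ a ∉ S) ∧ a' ∉ S)).card := by
    apply congrArg Finset.card
    apply filter_congr
    intro S hS
    constructor
    · rintro ⟨hp, _⟩
      exact hp
    · rintro ⟨⟨heS, haS⟩, ha'S⟩
      refine ⟨⟨⟨heS, haS⟩, ha'S⟩, ?_⟩
      have hSsub : S ⊆ ((gr N).erase a).erase a' := by
        intro y hy
        exact mem_erase.2 ⟨fun h' => ha'S (h' ▸ hy),
          mem_erase.2 ⟨fun h' => haS (h' ▸ hy), (mem_biIndepSets.1 hS).1 hy⟩⟩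
      rw [rk_insert_right_eq_add_one_of_seriesPair h hSsub, (mem_biIndepSets.1 hS).2.2.1,
        (mem_biIndepSets.1 hS).2.1]
  unfold inCount outCount
  rw [hD, hU, hboth, hD1, hU1]
  omega

end TwelveCaptureA

end PercRepro.Cogirth
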